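import Literature.NumberTheory.EllipticCurves.CastellaGrossiSkinner2025.AnticyclotomicMainConjectures
import Literature.NumberTheory.EllipticCurves.KellerYin2024.HeegnerPointMainConjecture
import Literature.NumberTheory.EllipticCurves.BurungaleCastellaSkinner2025.HeegnerPointMainConjecture
import Literature.NumberTheory.EllipticCurves.YanZhu2026.AnticyclotomicMainTheorems
import Literature.NumberTheory.EllipticCurves.BurungaleSkinnerTianWan2024.HeegnerMainStatementOPEN
import HarnessLib

/-!
# Perrin-Riou's Heegner point main conjecture ("Conjecture B" of Castella–Grossi–Skinner 2025) — an OBLIGATION leaf (`@[conjecture]`, nothing asserted), in the tree vocabulary shared by its typed instances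

HONEST FRAMING (cell `bsd-littype`, BSD share of the cross-ladder LITERATURE-TYPING layer, D-0088(4);
seat `bsd-littype-02`, staged gen 0, filed gen 4 next to the other typer-filed obligation leaves of
`Summits/BirchSwinnertonDyer/Rank1Residual/` — `SelmerCorankPConverse.lean`,
`TwistedHeegnerPointMainConjecture.lean`, `TwoVariableOrdinaryMainConjecture.lean`): conjectures are
not Literature. The Introduction of Castella–Grossi–Skinner, Math. Ann. 393 (2025) 2451–2506, numbers
its environments A (Theorem), **B (CONJECTURE — this one)**, C, D
(`\newtheorem{conj}[thmintro]{Conjecture}`, final TeX l.107–109): a "Theorem B" of that paper does not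
exist. This file states Conjecture B as an obligation `Prop` (per anticyclotomic datum:
`PerrinRiouHPMCAt`; closed over all data: `PerrinRiouHeegnerPointMainConjecture`) with LITERALLY the
conclusion of the tree's named facts that prove it on their loci — `CastellaGrossiSkinner2025.thmC_…`
(Math. Ann. 2025, Thm. C: good Eisenstein `p > 2`, `φ|_{G_p} ≠ 𝟙, ω`, (spl)),
`BurungaleCastellaSkinner2025.thm122b_…` (IMRN 2025, Thm. 1.2.2 (b): `p > 3`, (sur), (spl)),
`YanZhu2026.thm57_…` (J. Algebra 2026, Thm. 5.7 (2), integral clause: `ρ̄_E|_{G_K}` irreducible with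
full `p`-adic image, (spl)), the unrefereed CLAIMS `KellerYin2024.thmB_…_OPEN` (anomalous Eisenstein
`p`, (spl)) and `BurungaleSkinnerTianWan2024.thm129_heegnerMain_OPEN` /
`prop127_heegnerMain_of_mainStatements_OPEN` (arXiv:2409.01350, Thm. 12.9: (sur), (ram), `p ∣ c_ℓ·h_K`
allowed; Prop. 12.7: from Kato's main conjecture for `E`, `E ⊗ χ_K` and (HMC_ub)) — and the hypotheses
PRINTED in Conjecture B (which has no (spl), no image and no Selmer-corank condition), so that routes
and ideation cells can name the open cases BY NAME: an Eisenstein or residually irreducible `p` INERT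
in `K`; an anomalous Eisenstein `p` (`φ|_{G_p} ∈ {𝟙, ω}`, class X1 type A, where only the claim
`…_OPEN` is on record); irreducible NON-surjective image (class X9: Howard's divisibility via
`BurungaleCastellaKim2021.thm31_…`, the equality not in print for residually dihedral `p`, BCS 2025
Rem. 1.2.3). Kernel edges below: each typed instance implies the obligation on its locus
(`perrinRiouHPMCAt_of_thmC`, `_of_thm122b`, `_of_thm57`, `_of_thmB_OPEN`, `_of_thm129_OPEN`,
`_of_prop127_OPEN`), the obligation gives back Theorem C's statement (`thmC_of_perrinRiouHPMCAt`), the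
one-sided shapes in print (`howardThmB_dvd_of_perrinRiouHPMCAt`: the third clause of `Howard2004_thmB`,
and CGS25 Thm. 6.5.2's `J`-form `thm652_…` with `k = 0`) and the RATIONAL shape
`(C c)·char_Λ(𝔛_tors) ⊆ char_Λ(𝔖/𝐇)²` (`c = 1`) consumed as `hMC` by the tree's corank-one descent
(`BSDSelmerPConverseHeegnerSpecializationProofs.lean`, `analyticRankEK_eq_one_of_heegner_specialization`;
`BSDSelmerPConverseHeegnerIndexZeroProofs.lean`) (`rationalHPMC_of_perrinRiouHPMCAt`).

Source, verbatim (final TeX of the published version,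
`run/shared/lean/b2b/bsd-rank1-residual/b2b-bsdres-lit-cgls/src/cgs25-final/Mazur-paper_revised.tex`
l.476–483 = arXiv:2303.04373v2 §1.1; v1 LaTeXML "Conjecture 2", `[corpus: paper:arxiv-2303.04373 p0004]`):

> **Conjecture B (Perrin-Riou).** Let `E/ℚ` be an elliptic curve, `p > 2` a prime of good ordinary
> reduction for `E`, and let `K` be an imaginary quadratic field satisfying (Heeg) and (disc). Then
> `𝔖_ord(E/K_∞⁻)` and `𝔛_ord(E/K_∞⁻)` both have `Λ_K⁻`-rank one, and
> `char_{Λ_K⁻}(𝔛_ord(E/K_∞⁻)_tors) = char_{Λ_K⁻}(𝔖_ord(E/K_∞⁻)/(κ₁^{Hg}))²`,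
> where the subscript tors denotes the `Λ_K⁻`-torsion submodule.

with (l.442–448) (disc) "`D_K` is odd and `D_K ≠ −3`", (Heeg) "every prime `ℓ ∣ N` splits in `K`"
(`N` the conductor of `E`), `𝔖_ord(E/K_∞⁻) := lim←_n lim←_m Sel_{p^m}(E/K_n⁻)` "a compact
`Λ_K⁻`-module containing `κ₁^{Hg}`" (l.462–466), `𝔛_ord(E/K_∞⁻)` the Pontryagin dual of
`Sel_{p^∞}(E/K_∞⁻)`, `κ₁^{Hg}` the `Λ_K⁻`-adic Heegner class of a parametrisation `π : X₀(N) → E`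
(non-torsion: Cornut, Vatsal). ORIGINAL: B. Perrin-Riou, Bull. SMF 115 (1987) 399–456, §1,
"CONJECTURE B" on printed p. 405 (`[corpus: paper:doi-10-24033-bsmf-2085 p0008]`): "Si les
`Λ`-modules `H_∞` et `S_p(D_∞)` sont de rang 1, [the characteristic series of the `Λ`-torsion of the
dual Selmer module equals `I(H_∞) · I(H_∞)^ι` up to a unit]" — the modern square `I(H_∞)²` is Howard's
form (Howard 2004 Thm. B (a): `ch(M) = ch(M)^ι`); this file types the statement AS PRINTED BY CGS.
STATUS IN PRINT (CGS l.485–509 and the tree): proved on the three refereed loci above, claimed on three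
preprint loci; Howard 2004 Thm. B / Burungale–Castella–Kim 2021 Thm. 3.1 give the divisibility
`char(𝔛_tors) ∣ char(𝔖/𝐇)²` under surjective / irreducible image; CGS25 Thm. 6.5.2 gives it in
`Λ[1/p]` under `E(K)[p] = 0`; further published cases (other image or ramification hypotheses) are
not typed in the tree and are not listed here. OPEN as printed in the remaining cases.

TRANSCRIPTION = that of `thmC_…` (module docstring of
`CastellaGrossiSkinner2025/HeegnerPointMainConjecture.lean`, items 1–7), with Conjecture B's OWN
hypotheses: `p > 2` of good ORDINARY reduction (`IsOrdinaryAt W p`; no reducibility, no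
`φ`-condition, no (spl), no (Sel), no `p ∤ D_K`), (Heeg), (disc); plus the SAME EXTRA standing
hypothesis `p ∤ h_K` of the tree's Heegner-family vocabulary (Howard 2004 Thm. 3.3.7:
`heegnerModule D F = Λκ₁^{Hg}`), flagged `-- TODO(general form)`. Nothing is asserted.

References: [CastellaGrossiSkinner2025] Conj. B (l.476–483), Thm. C (l.506–509), Thm. 6.5.2, Cor. 6.5.4;
[PerrinRiou1987BSMF] §1 Conjecture B (p. 405); [Howard2004HeegnerKolyvagin] Thm. B, Thm. 3.3.7;
[BurungaleCastellaSkinner2025] Thm. 1.2.2 (b), Rem. 1.2.3; [YanZhu2024MainConjNonCM] Thm. 5.7 (2);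
[KellerYin2024] Thm. B (claim); [BurungaleSkinnerTianWan2024] Prop. 12.7, Thm. 12.9 (claims); tree
`HeegnerModuleIndex.lean`, `CastellaGrossiSkinner2025/{HeegnerPointMainConjecture,AnticyclotomicMainConjectures}.lean`,
`KellerYin2024/HeegnerPointMainConjecture.lean`, `BurungaleCastellaSkinner2025/HeegnerPointMainConjecture.lean`,
`YanZhu2026/AnticyclotomicMainTheorems.lean`, `BurungaleSkinnerTianWan2024/HeegnerMainStatementOPEN.lean`,
`BSDSelmerPConverseHeegnerSpecializationProofs.lean`.
-/

noncomputable section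

open scoped Classical

open WeierstrassCurve NumberField IsDedekindDomain Field Literature.NumberTheory.EllipticCurves
  Literature.NumberTheory.EllipticCurves.Rank1Residual
  Literature.NumberTheory.EllipticCurves.CastellaGrossiSkinner2025

universe u

namespace Summit.BirchSwinnertonDyer.Rank1Residual.PerrinRiouHPMC

variable (N : ℕ) [NeZero N] (W : WeierstrassCurve ℚ) [W.IsGloballyMinimal] (K : Type u) [Field K]
  [NumberField K] (p : ℕ) [Fact p.Prime] (κ : ZpExtension K p) (γ : Field.absoluteGaloisGroup K)
  (jbar : AlgebraicClosure K →+* ℂ)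

/-- **Hypotheses of Conjecture B (Perrin-Riou) as printed by Castella–Grossi–Skinner 2025**
(l.476–479): "`E/ℚ` an elliptic curve [of conductor `N`], `p > 2` a prime of good ordinary reduction
for `E`, `K` an imaginary quadratic field satisfying (Heeg) and (disc)"; `κ` the anticyclotomic
`ℤ_p`-extension, `γ` a topological generator; and the EXTRA standing hypothesis `p ∤ h_K` of the tree's
Heegner-family vocabulary (Howard 2004 Thm. 3.3.7; not printed — special case, as in
`ThmCHypotheses` / `Thm652Hypotheses`). NO splitting, `p ∤ D_K`, reducibility, image, parity or
Selmer-corank condition. [cite: CastellaGrossiSkinner2025, Conjecture B (§1.1, final TeX l.476–483) with (Heeg), (disc) (l.442–448)] -/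
structure PerrinRiouHypotheses : Prop where
  /-- `E` is an elliptic curve. -/
  isElliptic : W.IsElliptic
  /-- `N` is the conductor of `E` (the level of the Heegner family). -/
  level : N = W.conductorNorm ℤ
  /-- `p > 2`. -/
  two_lt : 2 < p
  /-- good ORDINARY reduction at `p`. -/
  ordinary : IsOrdinaryAt W p
  /-- `K` is imaginary quadratic. -/
  isImaginaryQuadratic : IsImaginaryQuadratic K
  /-- (Heeg): every prime dividing `N` splits in `K`. -/
  heegner : SatisfiesHeegnerHypothesis N K
  /-- (disc): `D_K` is odd. -/
  discr_odd : Odd (NumberField.discr K)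
  /-- (disc): `D_K ≠ -3`. -/
  discr_ne : NumberField.discr K ≠ -3
  /-- EXTRA (tree Heegner-family vocabulary, Howard 2004 Thm. 3.3.7): `p ∤ h_K`. -/
  not_dvd_classNumber : ¬ p ∣ NumberField.classNumber K
  /-- `κ` is the anticyclotomic `ℤ_p`-extension of `K`. -/
  anticyclotomic : κ.IsAnticyclotomic
  /-- `γ` is a topological generator of `Gal(K_∞⁻/K)`. -/
  topGenerator : κ.IsTopGenerator γ

-- TODO(general form): Perrin-Riou / CGS allow `p ∣ h_K`; `not_dvd_classNumber` is the tree vocabulary's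
-- standing hypothesis under which `heegnerModule D F = Λκ₁^{Hg}` (Howard 2004 Thm. 3.3.7).

/-- **Conjecture B (Perrin-Riou) at one anticyclotomic datum** `(E, N, K, p, κ, γ)` — the OBLIGATION:
under `PerrinRiouHypotheses`, for every `Λ`-adic Selmer datum `D` (`𝔖_ord(E/K_∞⁻)`), Heegner family `F`
at level `N` and Selmer-dual datum `X` (`𝔛_ord(E/K_∞⁻)`): `𝔖` and `𝔛` are finitely generated of
`Λ`-rank one and `char_Λ(𝔛_{Λ-tors}) = char_Λ(𝔖/𝐇)²` (`𝐇 = heegnerModule D F = Λκ₁^{Hg}`) — LITERALLY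
the conclusion of the tree fact `thmC_charIdeal_torsion_eq_heegnerCharIdeal_sq`. Nothing asserted.
[cite: CastellaGrossiSkinner2025, Conjecture B (§1.1, l.476–483)] [cite: PerrinRiou1987BSMF, §1 Conjecture B (p. 405)] -/
@[conjecture] def PerrinRiouHPMCAt : Prop :=
  ∀ (_ : PerrinRiouHypotheses N W K p κ γ) (D : (W.baseChange K).LambdaAdicSelmerData κ γ)
    (F : HeegnerFamily N W K κ jbar) (X : (W.baseChange K).SelmerDualData κ γ),
    (Module.Finite (IwasawaAlgebra p) D.S ∧ Module.finrank (IwasawaAlgebra p) D.S = 1) ∧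
    (Module.Finite (IwasawaAlgebra p) X.X ∧ Module.finrank (IwasawaAlgebra p) X.X = 1 ∧
      Module.charIdeal (IwasawaAlgebra p) (Submodule.torsion (IwasawaAlgebra p) X.X) =
        heegnerCharIdeal D F ^ 2)

/-- **Conjecture B (Perrin-Riou), closed form** — for EVERY elliptic `E/ℚ` (globally minimal model `W`,
conductor `N`), prime `p > 2` of good ordinary reduction, imaginary quadratic `K` with (Heeg), (disc)
[and the tree's `p ∤ h_K`], anticyclotomic `κ` with topological generator `γ`, and complex embedding
datum `jbar`: `PerrinRiouHPMCAt`. OPEN in print outside the loci listed in the module docstring.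
[cite: CastellaGrossiSkinner2025, Conjecture B (§1.1, l.476–483)] [cite: PerrinRiou1987BSMF, §1 Conjecture B (p. 405)] -/
@[conjecture] def PerrinRiouHeegnerPointMainConjecture : Prop :=
  ∀ (N : ℕ) [NeZero N] (W : WeierstrassCurve ℚ) [W.IsGloballyMinimal] (K : Type) [Field K]
    [NumberField K] (p : ℕ) [Fact p.Prime] (κ : ZpExtension K p) (γ : Field.absoluteGaloisGroup K)
    (jbar : AlgebraicClosure K →+* ℂ), PerrinRiouHPMCAt N W K p κ γ jbar

variable {N W K p κ γ jbar}

/-! ### Hypothesis dictionaries: the printed loci are special cases of Conjecture B's hypotheses -/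

omit [NeZero N] in
/-- Theorem C's hypotheses (CGS25) are a special case of Conjecture B's (`p > 2` good Eisenstein ⇒ good
ordinary, tree `goodOrd_of_red_of_good`; (spl) and `φ|_{G_p} ≠ 𝟙, ω` are dropped).
[cite: CastellaGrossiSkinner2025, Thm. C vs Conj. B (§1.1)] -/
theorem PerrinRiouHypotheses.of_thmCHypotheses (hC : ThmCHypotheses N W K p κ γ) :
    PerrinRiouHypotheses N W K p κ γ where
  isElliptic := hC.isElliptic
  level := hC.level
  two_lt := hC.two_lt
  ordinary := (isOrdinaryAt_iff W p).mpr hC.p_ne_two_and_goodOrd.2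
  isImaginaryQuadratic := hC.isImaginaryQuadratic
  heegner := hC.heegner
  discr_odd := hC.discr_odd
  discr_ne := hC.discr_ne
  not_dvd_classNumber := hC.not_dvd_classNumber
  anticyclotomic := hC.anticyclotomic
  topGenerator := hC.topGenerator

omit [NeZero N] in
/-- Keller–Yin's Theorem B hypotheses (good Eisenstein `p > 2`, possibly anomalous, (spl)) are a special
case of Conjecture B's. [cite: CastellaGrossiSkinner2025, Conj. B (§1.1)] [claim: KellerYin2024, status: under-review] -/
theorem PerrinRiouHypotheses.of_thmBHypotheses (hB : KellerYin2024.ThmBHypotheses N W K p κ γ) :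
    PerrinRiouHypotheses N W K p κ γ where
  isElliptic := hB.isElliptic
  level := hB.level
  two_lt := hB.two_lt
  ordinary := (isOrdinaryAt_iff W p).mpr hB.p_ne_two_and_goodOrd.2
  isImaginaryQuadratic := hB.isImaginaryQuadratic
  heegner := hB.heegner
  discr_odd := hB.discr_odd
  discr_ne := hB.discr_ne
  not_dvd_classNumber := hB.not_dvd_classNumber
  anticyclotomic := hB.anticyclotomic
  topGenerator := hB.topGenerator

omit [NeZero N] in
/-- Burungale–Castella–Skinner's Theorem 1.2.2 data (`p > 3` good ordinary, (disc), (Heeg), (spl)) are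
a special case of Conjecture B's. [cite: BurungaleCastellaSkinner2025, Thm. 1.2.2 (data), §1.2 p. 3] -/
theorem PerrinRiouHypotheses.of_thm122Hypotheses
    (h : BurungaleCastellaSkinner2025.Thm122Hypotheses N W K p κ γ) :
    PerrinRiouHypotheses N W K p κ γ where
  isElliptic := h.isElliptic
  level := h.level
  two_lt := lt_trans (by norm_num) h.three_lt
  ordinary := (isOrdinaryAt_iff W p).mpr h.goodOrd
  isImaginaryQuadratic := h.isImaginaryQuadratic
  heegner := h.heegner
  discr_odd := h.discr_odd
  discr_ne := h.discr_ne
  not_dvd_classNumber := h.not_dvd_classNumber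
  anticyclotomic := h.anticyclotomic
  topGenerator := h.topGenerator

omit [NeZero N] in
/-- Yan–Zhu's Theorem 5.7 setting (`p ≥ 3` good ordinary, `ρ̄_E|_{G_K}` irreducible, (Heeg), (spl),
`D_K` odd `≠ −3`) is a special case of Conjecture B's hypotheses.
[cite: YanZhu2024MainConjNonCM, Thm. 5.7 setting (§5.2, arXiv v4 l.1189–1190)] -/
theorem PerrinRiouHypotheses.of_thm57Hypotheses (h : YanZhu2026.Thm57Hypotheses N W K p κ γ) :
    PerrinRiouHypotheses N W K p κ γ where
  isElliptic := h.isElliptic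
  level := h.level
  two_lt := Nat.succ_le_iff.mp h.three_le
  ordinary := (isOrdinaryAt_iff W p).mpr h.goodOrd
  isImaginaryQuadratic := h.isImaginaryQuadratic
  heegner := h.heegner
  discr_odd := h.discr_odd
  discr_ne := h.discr_ne
  not_dvd_classNumber := h.not_dvd_classNumber
  anticyclotomic := h.anticyclotomic
  topGenerator := h.topGenerator

/-! ### Kernel edges: the typed instances settle the obligation on their loci -/

/-- **The obligation gives back Theorem C's statement** on Theorem C's locus (trivial; recorded so the
two names are visibly the same shape). [cite: CastellaGrossiSkinner2025, Thm. C ("Then Conjecture B holds")] -/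
theorem thmC_of_perrinRiouHPMCAt (h : PerrinRiouHPMCAt N W K p κ γ jbar) :
    thmC_charIdeal_torsion_eq_heegnerCharIdeal_sq N W K p κ γ jbar :=
  fun hC D F X ↦ h (PerrinRiouHypotheses.of_thmCHypotheses hC) D F X

/-- **Castella–Grossi–Skinner 2025 Thm. C discharges the obligation on its locus**: granted the
published fact `thmC_…`, `PerrinRiouHPMCAt` holds at every datum satisfying `ThmCHypotheses` (good
Eisenstein `p > 2`, `φ|_{G_p} ≠ 𝟙, ω`, (Heeg), (disc), (spl)). [cite: CastellaGrossiSkinner2025, Thm. C = Cor. 6.5.4] -/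
theorem perrinRiouHPMCAt_of_thmC (h : thmC_charIdeal_torsion_eq_heegnerCharIdeal_sq N W K p κ γ jbar)
    (hC : ThmCHypotheses N W K p κ γ) : PerrinRiouHPMCAt N W K p κ γ jbar :=
  fun _ D F X ↦ h hC D F X

/-- **Burungale–Castella–Skinner 2025 Thm. 1.2.2 (b) discharges the obligation on its locus** (`p > 3`
good ordinary, (sur), (disc), (Heeg), (spl)). [cite: BurungaleCastellaSkinner2025, Thm. 1.2.2 (b) (§1.2, p. 3)] -/
theorem perrinRiouHPMCAt_of_thm122b
    (h : BurungaleCastellaSkinner2025.thm122b_rankOne_charIdeal_torsion_eq_heegnerCharIdeal_sq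
      N W K p κ γ jbar)
    (hyp : BurungaleCastellaSkinner2025.Thm122Hypotheses N W K p κ γ) (hsur : Surj W p) :
    PerrinRiouHPMCAt N W K p κ γ jbar :=
  fun _ D F X ↦ h hyp hsur D F X

/-- **Yan–Zhu 2026 Thm. 5.7 (2), integral clause, discharges the obligation on its locus** (`p ≥ 3`
good ordinary, `ρ̄_E|_{G_K}` irreducible, `ρ_E(G_K) = Aut_{ℤ_p}(T_pE)`, (Heeg), (spl), `D_K` odd `≠ −3`).
[cite: YanZhu2024MainConjNonCM, Thm. 5.7 (2), integral clause (arXiv v4 l.1236–1241)] -/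
theorem perrinRiouHPMCAt_of_thm57
    (h : YanZhu2026.thm57_rankOne_charIdealTorsion_eq_heegnerCharIdeal_sq N W K p κ γ jbar)
    (hyp : YanZhu2026.Thm57Hypotheses N W K p κ γ)
    (hsurj : ∀ u : Module.End ℤ_[p] ((W.baseChange K).tateModule p), IsUnit u →
      u ∈ Set.range (galoisRepTate (W.baseChange K) p)) :
    PerrinRiouHPMCAt N W K p κ γ jbar := by
  intro _ D F X
  obtain ⟨hS, ⟨hX, hX1⟩, -, hint⟩ := h hyp D F X
  exact ⟨hS, hX, hX1, hint hsurj⟩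

/-- **Keller–Yin's CLAIM (Thm. B, unrefereed) would discharge the obligation on the anomalous
Eisenstein locus** — CONDITIONAL on the `_OPEN` hypothesis; never cite as a theorem.
[claim: KellerYin2024, status: under-review] [cite: CastellaGrossiSkinner2025, Conj. B (§1.1)] -/
theorem perrinRiouHPMCAt_of_thmB_OPEN
    (h : KellerYin2024.thmB_imc1_charIdeal_torsion_eq_heegnerCharIdeal_sq_OPEN N W K p κ γ jbar)
    (hB : KellerYin2024.ThmBHypotheses N W K p κ γ) : PerrinRiouHPMCAt N W K p κ γ jbar :=
  fun _ D F X ↦ h hB D F X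

/-- **Burungale–Skinner–Tian–Wan's CLAIM (arXiv:2409.01350, Thm. 12.9, unrefereed) would discharge the
obligation on its locus** — `p`-adic tower surjective (⇒ (irr_ℚ), (irr_K), (sur)), (ram) = `Ram W p`,
`p` split in `K`, `(D_K, N) = 1`; CONDITIONAL on the `_OPEN` hypothesis; never cite as a theorem. Good
ordinary reduction, (Heeg), `p ∤ h_K`, the tower and `N = N_E` come from `PerrinRiouHypotheses`; its
(disc) is not used by the claim. [claim: BurungaleSkinnerTianWan2024, status: under-review]
[cite: BurungaleSkinnerTianWan2024, Thm. 12.9 (p. 98)] [cite: CastellaGrossiSkinner2025, Conj. B (§1.1)] -/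
theorem perrinRiouHPMCAt_of_thm129_OPEN
    (h : BurungaleSkinnerTianWan2024.thm129_heegnerMain_OPEN.{u})
    (hsur : ∀ n : ℕ, W.HasSurjectiveModNGaloisRep ((p : ℤ) ^ n)) (hram : Ram W p)
    (hsplit : ((Ideal.span {(p : ℤ)}).primesOver (𝓞 K)).ncard = 2)
    (hcop : IsCoprime (NumberField.discr K) (W.conductorNorm ℤ)) :
    PerrinRiouHPMCAt N W K p κ γ jbar := by
  intro hyp D F X
  haveI : W.IsElliptic := hyp.isElliptic
  obtain ⟨-, hlevel, h2, hord, hK, hHeeg, -, -, hh, hκ, hγ⟩ := hyp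
  subst hlevel
  exact h W K p κ γ jbar (Nat.ne_of_gt h2) hord.1 hord.2 hsur hram hK hsplit hcop hHeeg hh hκ hγ D F X

/-- **Burungale–Skinner–Tian–Wan's CLAIM (arXiv:2409.01350, Prop. 12.7, unrefereed): Kato's main
conjecture for `E` and for `E ⊗ χ_K` (integral, Néron form `CharIdealEqPadicLFunctionNeron`) together
with the Howard-type divisibility (HMC_ub) would discharge the obligation** on its locus — `E` non-CM
(elliptic as an instance: the cyclotomic statements are stated over `[W.IsElliptic]`), `p ∤ #E(ℚ)_tors`, `p ∤ #E^{(D_K)}(ℚ)_tors` (`W'` a globally minimal model of the twist), `p` split in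
`K`, `(D_K, N) = 1`; CONDITIONAL on the `_OPEN` hypothesis; never cite as a theorem.
[claim: BurungaleSkinnerTianWan2024, status: under-review]
[cite: BurungaleSkinnerTianWan2024, Prop. 12.7 with (HMC_ub) (pp. 97–98)] [cite: CastellaGrossiSkinner2025, Conj. B (§1.1)] -/
theorem perrinRiouHPMCAt_of_prop127_OPEN
    (h : BurungaleSkinnerTianWan2024.prop127_heegnerMain_of_mainStatements_OPEN.{u})
    [W.IsElliptic] (W' : WeierstrassCurve ℚ) [W'.IsElliptic] [W'.IsGloballyMinimal]
    {C : VariableChange ℚ} (hcm : ¬ W.HasCM) (hvan : ¬ p ∣ W.torsionOrder)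
    (hsplit : ((Ideal.span {(p : ℤ)}).primesOver (𝓞 K)).ncard = 2)
    (hcop : IsCoprime (NumberField.discr K) (W.conductorNorm ℤ))
    (hC : C • W' = W.quadraticTwist (NumberField.discr K : ℚ)) (hvan' : ¬ p ∣ W'.torsionOrder)
    (hub : ∀ (D : (W.baseChange K).LambdaAdicSelmerData κ γ)
        (F : HeegnerFamily N W K κ jbar) (X : (W.baseChange K).SelmerDualData κ γ),
        Module.charIdeal (IwasawaAlgebra p) (Submodule.torsion (IwasawaAlgebra p) X.X) ∣
          heegnerCharIdeal D F ^ 2)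
    (hMC : BurungaleSkinnerTianWan2024.CharIdealEqPadicLFunctionNeron W p)
    (hMC' : BurungaleSkinnerTianWan2024.CharIdealEqPadicLFunctionNeron W' p) :
    PerrinRiouHPMCAt N W K p κ γ jbar := by
  intro hyp D F X
  obtain ⟨-, hlevel, h2, hord, hK, hHeeg, -, -, hh, hκ, hγ⟩ := hyp
  subst hlevel
  exact h W W' K p κ γ jbar C hcm (Nat.ne_of_gt h2) hord.1 hord.2 hvan hK hsplit hcop hHeeg hh hC
    hvan' hκ hγ hub hMC hMC' D F X

/-! ### Kernel edges: what the obligation gives -/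

/-- **Conjecture B ⇒ the one-sided shapes in print**: Howard's divisibility `char_Λ(𝔛_tors) ∣
char_Λ(𝔖/𝐇)²` (the third clause of `Howard2004_thmB`) and CGS25 Thm. 6.5.2's `J`-form
(`thm652_rankOne_charIdeal_torsion_eq_sq_dvd`) with `k = 0`.
[cite: CastellaGrossiSkinner2025, Conj. B, Thm. 6.5.2] [cite: Howard2004HeegnerKolyvagin, Thm. B (c)] -/
theorem howardThmB_dvd_of_perrinRiouHPMCAt (h : PerrinRiouHPMCAt N W K p κ γ jbar)
    (hyp : PerrinRiouHypotheses N W K p κ γ) (D : (W.baseChange K).LambdaAdicSelmerData κ γ)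
    (F : HeegnerFamily N W K κ jbar) (X : (W.baseChange K).SelmerDualData κ γ) :
    Module.charIdeal (IwasawaAlgebra p) (Submodule.torsion (IwasawaAlgebra p) X.X) ∣
        heegnerCharIdeal D F ^ 2 ∧
      ∃ (J : Ideal (IwasawaAlgebra p)) (k : ℕ),
        Module.charIdeal (IwasawaAlgebra p) (Submodule.torsion (IwasawaAlgebra p) X.X) = J ^ 2 ∧
        J ∣ Ideal.span {(p : IwasawaAlgebra p) ^ k} * heegnerCharIdeal D F := by
  obtain ⟨-, -, -, heq⟩ := h hyp D F X
  exact ⟨dvd_of_eq heq, heegnerCharIdeal D F, 0, heq, by simp⟩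

/-- **Conjecture B ⇒ the RATIONAL main-conjecture input of the corank-one descent**: with `c = 1`,
`(C c) · char_Λ(𝔛_tors) ⊆ char_Λ(𝔖/𝐇)²` — exactly the hypothesis `hMC` of
`analyticRankEK_eq_one_of_heegner_specialization` / `heegnerModuleIndex_eq_zero_of_rational_mainConjecture`
(Yan–Zhu 2026, proof of Thm. 4.15: "descent arguments to (the rational part of) Theorem 4.12 (2)").
[cite: CastellaGrossiSkinner2025, Conj. B (§1.1)] [cite: YanZhu2024MainConjNonCM, Thm. 4.15 (proof, §4.6)] -/
theorem rationalHPMC_of_perrinRiouHPMCAt (h : PerrinRiouHPMCAt N W K p κ γ jbar)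
    (hyp : PerrinRiouHypotheses N W K p κ γ) (D : (W.baseChange K).LambdaAdicSelmerData κ γ)
    (F : HeegnerFamily N W K κ jbar) (X : (W.baseChange K).SelmerDualData κ γ) :
    (1 : ℤ_[p]) ≠ 0 ∧
      Ideal.span {(PowerSeries.C (1 : ℤ_[p]) : IwasawaAlgebra p)} *
          Module.charIdeal (IwasawaAlgebra p) (Submodule.torsion (IwasawaAlgebra p) X.X) ≤
        heegnerCharIdeal D F ^ 2 := by
  obtain ⟨-, -, -, heq⟩ := h hyp D F X
  refine ⟨one_ne_zero, ?_⟩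
  rw [map_one, Ideal.span_singleton_one, Ideal.top_mul]
  exact heq.le

/-- **The closed conjecture specialises to every datum** (with `K : Type`), in particular it gives
Theorem C's statement everywhere. [cite: CastellaGrossiSkinner2025, Conj. B and Thm. C (§1.1)] -/
theorem thmC_of_perrinRiouHeegnerPointMainConjecture (h : PerrinRiouHeegnerPointMainConjecture)
    (N : ℕ) [NeZero N] (W : WeierstrassCurve ℚ) [W.IsGloballyMinimal] (K : Type) [Field K]
    [NumberField K] (p : ℕ) [Fact p.Prime] (κ : ZpExtension K p) (γ : Field.absoluteGaloisGroup K)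
    (jbar : AlgebraicClosure K →+* ℂ) :
    thmC_charIdeal_torsion_eq_heegnerCharIdeal_sq N W K p κ γ jbar :=
  thmC_of_perrinRiouHPMCAt (h N W K p κ γ jbar)

end Summit.BirchSwinnertonDyer.Rank1Residual.PerrinRiouHPMC

end
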